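import Mathlib
import HarnessLib

/-!
# Trigonometric sums over the lattice diamond (Dirichlet and odd-sine identities)

Solo-blind residency `solo-HubbardSuperconductivity-blind`, session 7, Theorem 15 (part 1 of 3):
the elementary trigonometry behind the diamond trial Fermi sea used to discharge requirement R9
(the spin wall of Theorem 14) at weak coupling.  For `K : ℕ` the lattice diamond is coded on
`ℕ × ℕ` as `diamondN K = {(s, t) ∈ [0, 2K]² : |s - K| + |t - K| ≤ K}`; its rows are the integer
intervals `[K - w_t, K + w_t]`, `w_t = min t (2K - t)`.  We prove

* `two_mul_sin_half_mul_sum_cos`, `sin_half_mul_dir` — the Dirichlet kernel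
  `dir w θ = Σ_{|j| ≤ w} cos(jθ)` and `sin(θ/2) · dir w θ = sin((2w+1)θ/2)`;
* `sin_mul_sum_sin_odd` — `sin x · Σ_{u<K} sin((2u+1)x) = sin²(Kx)`;
* `card_diamondN` — `|diamondN K| = 2K² + 2K + 1`;
* `diamondSum_eq_two_mul`, `sin_sq_mul_rowDirSum` — the diamond sum
  `S_K(θ) = Σ_{(s,t)} (cos((s-K)θ) + cos((t-K)θ)) = 2 Σ_t dir w_t θ` in closed form,
  `sin²(θ/2) Σ_t dir w_t θ = sin(θ/2) sin((2K+1)θ/2) + 2 sin²(Kθ/2)`;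
* `diamondSum_ge` — for `θ = 2π/L`, `2K + 1 ≤ L`: `S_K(2π/L) ≥ 4 L² sin²(Kπ/L)/π²`.

Elementary; no sorry.  [folklore] (Dirichlet 1829; Fejér 1904.)
-/

noncomputable section

namespace Summit.HubbardSuperconductivity.HubbardSuperconductivity.Theorems.WeakCouplingSpin

open Finset Real

/-! ### One-dimensional identities -/

/-- **Dirichlet's identity, one-sided form**:
`2 sin(θ/2) Σ_{u<J} cos((u+1)θ) = sin((2J+1)θ/2) - sin(θ/2)` (telescoping). [folklore] -/
theorem two_mul_sin_half_mul_sum_cos (θ : ℝ) (J : ℕ) :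
    2 * sin (θ / 2) * ∑ u ∈ range J, cos (((u : ℝ) + 1) * θ) =
      sin ((2 * (J : ℝ) + 1) * θ / 2) - sin (θ / 2) := by
  induction J with
  | zero => simp
  | succ J ih =>
    rw [sum_range_succ, mul_add, ih]
    have h1 : (2 * ((J + 1 : ℕ) : ℝ) + 1) * θ / 2 = ((J : ℝ) + 1) * θ + θ / 2 := by
      push_cast; ring
    have h2 : (2 * (J : ℝ) + 1) * θ / 2 = ((J : ℝ) + 1) * θ - θ / 2 := by ring
    rw [h1, h2, sin_add, sin_sub]
    ring

/-- **Odd-sine identity**: `sin x · Σ_{u<K} sin((2u+1)x) = sin²(Kx)` (telescoping). [folklore] -/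
theorem sin_mul_sum_sin_odd (x : ℝ) (K : ℕ) :
    sin x * ∑ u ∈ range K, sin ((2 * (u : ℝ) + 1) * x) = sin ((K : ℝ) * x) ^ 2 := by
  induction K with
  | zero => simp
  | succ K ih =>
    rw [sum_range_succ, mul_add, ih]
    have hc1 : cos (2 * ((K : ℝ) * x)) = cos ((2 * (K : ℝ) + 1) * x) * cos x +
        sin ((2 * (K : ℝ) + 1) * x) * sin x := by
      rw [show 2 * ((K : ℝ) * x) = (2 * (K : ℝ) + 1) * x - x by ring, cos_sub]
    have hc2 : cos (2 * (((K + 1 : ℕ) : ℝ) * x)) = cos ((2 * (K : ℝ) + 1) * x) * cos x -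
        sin ((2 * (K : ℝ) + 1) * x) * sin x := by
      rw [show 2 * (((K + 1 : ℕ) : ℝ) * x) = (2 * (K : ℝ) + 1) * x + x by push_cast; ring, cos_add]
    have hs : ∀ y : ℝ, sin y ^ 2 = 1 / 2 - cos (2 * y) / 2 := fun y => by rw [sin_sq, cos_sq]; ring
    rw [hs, hs, hc1, hc2]
    ring

/-! ### Symmetric sums folded onto `ℕ` -/

/-- Folding a symmetric sum: for `t < 2K+1` put `w_t = min t (2K - t)`; then
`Σ_{t<2K+1} g(w_t) = g K + 2 Σ_{u<K} g u`. [folklore] -/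
theorem sum_range_min_eq (g : ℕ → ℝ) (K : ℕ) :
    ∑ t ∈ range (2 * K + 1), g (min t (2 * K - t)) = g K + 2 * ∑ u ∈ range K, g u := by
  rw [show 2 * K + 1 = (K + 1) + K by ring, sum_range_add, sum_range_succ]
  have h1 : ∑ t ∈ range K, g (min t (2 * K - t)) = ∑ u ∈ range K, g u := by
    refine sum_congr rfl fun t ht => ?_
    rw [mem_range] at ht
    rw [min_eq_left (by omega)]
  have h2 : ∑ i ∈ range K, g (min (K + 1 + i) (2 * K - (K + 1 + i))) = ∑ u ∈ range K, g u := by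
    rw [← sum_range_reflect g K]
    refine sum_congr rfl fun i hi => ?_
    rw [mem_range] at hi
    congr 1
    omega
  rw [h1, h2, min_eq_left (by omega)]
  ring

/-! ### The Dirichlet kernel -/

/-- The Dirichlet kernel of half-width `w`, coded on `[0, 2w]`:
`dir w θ = Σ_{i<2w+1} cos((i - w)θ) = Σ_{|j| ≤ w} cos(jθ)`. [folklore] -/
def dir (w : ℕ) (θ : ℝ) : ℝ := ∑ i ∈ range (2 * w + 1), cos (((i : ℝ) - w) * θ)

/-- `dir w θ = 1 + 2 Σ_{u<w} cos((u+1)θ)` (cosine is even). [folklore] -/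
theorem dir_eq (w : ℕ) (θ : ℝ) : dir w θ = 1 + 2 * ∑ u ∈ range w, cos (((u : ℝ) + 1) * θ) := by
  unfold dir
  rw [show 2 * w + 1 = (w + 1) + w by ring, sum_range_add, sum_range_succ]
  have h1 : ∑ i ∈ range w, cos (((i : ℝ) - w) * θ) = ∑ u ∈ range w, cos (((u : ℝ) + 1) * θ) := by
    rw [← sum_range_reflect (fun u : ℕ => cos (((u : ℝ) + 1) * θ)) w]
    refine sum_congr rfl fun i hi => ?_
    rw [mem_range] at hi
    rw [← cos_neg]
    congr 1
    rw [Nat.cast_sub (by omega), Nat.cast_sub (by omega)]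
    push_cast
    ring
  have h2 : ∑ i ∈ range w, cos ((((w + 1 + i : ℕ) : ℝ) - w) * θ) =
      ∑ u ∈ range w, cos (((u : ℝ) + 1) * θ) := by
    refine sum_congr rfl fun i _ => ?_
    push_cast
    ring_nf
  have h0 : cos (((w : ℝ) - w) * θ) = 1 := by rw [sub_self, zero_mul, cos_zero]
  rw [h1, h2, h0]
  ring

/-- **`sin(θ/2) · dir w θ = sin((2w+1)θ/2)`**. [folklore] -/
theorem sin_half_mul_dir (w : ℕ) (θ : ℝ) : sin (θ / 2) * dir w θ = sin ((2 * (w : ℝ) + 1) * θ / 2) := by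
  rw [dir_eq, mul_add, mul_one, ← mul_assoc, mul_comm (sin (θ / 2)) 2, two_mul_sin_half_mul_sum_cos]
  ring

/-- The folded row sum of Dirichlet kernels over the diamond, `Σ_{t<2K+1} dir w_t θ`, in closed
form: `sin²(θ/2) · Σ_t dir w_t θ = sin(θ/2) sin((2K+1)θ/2) + 2 sin²(Kθ/2)`. [folklore] -/
theorem sin_sq_mul_rowDirSum (K : ℕ) (θ : ℝ) :
    sin (θ / 2) ^ 2 * ∑ t ∈ range (2 * K + 1), dir (min t (2 * K - t)) θ =
      sin (θ / 2) * sin ((2 * (K : ℝ) + 1) * θ / 2) + 2 * sin ((K : ℝ) * (θ / 2)) ^ 2 := by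
  rw [sum_range_min_eq (fun w => dir w θ) K, sq, mul_assoc, mul_add, sin_half_mul_dir,
    ← mul_assoc, mul_comm (sin (θ / 2)) 2, mul_assoc, mul_sum]
  simp_rw [sin_half_mul_dir]
  rw [← sin_mul_sum_sin_odd (θ / 2) K]
  have : ∀ u : ℕ, (2 * (u : ℝ) + 1) * θ / 2 = (2 * (u : ℝ) + 1) * (θ / 2) := fun u => by ring
  simp_rw [this]
  ring

/-! ### The lattice diamond coded on `ℕ × ℕ` -/

/-- The lattice diamond `|s - K| + |t - K| ≤ K` inside `[0, 2K]²`, in linear `ℕ`-form. [folklore] -/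
def diamondN (K : ℕ) : Finset (ℕ × ℕ) :=
  (range (2 * K + 1) ×ˢ range (2 * K + 1)).filter
    fun p => K ≤ p.1 + p.2 ∧ p.1 + p.2 ≤ 3 * K ∧ p.1 ≤ p.2 + K ∧ p.2 ≤ p.1 + K

/-- The row of the diamond at height `t ≤ 2K` is the integer interval
`[K - w_t, K + w_t]`, `w_t = min t (2K - t)`. [folklore] -/
theorem diamondN_row (K t : ℕ) (ht : t < 2 * K + 1) :
    (range (2 * K + 1)).filter (fun s => K ≤ s + t ∧ s + t ≤ 3 * K ∧ s ≤ t + K ∧ t ≤ s + K) =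
      Ico (K - min t (2 * K - t)) (K + min t (2 * K - t) + 1) := by
  ext s
  simp only [mem_filter, mem_range, mem_Ico]
  rcases le_total t K with h | h
  · rw [min_eq_left (by omega)]; omega
  · rw [min_eq_right (by omega)]; omega

/-- **Row decomposition of a sum over the diamond.** [folklore] -/
theorem sum_diamondN_eq (K : ℕ) (F : ℕ × ℕ → ℝ) :
    ∑ p ∈ diamondN K, F p = ∑ t ∈ range (2 * K + 1),
      ∑ s ∈ Ico (K - min t (2 * K - t)) (K + min t (2 * K - t) + 1), F (s, t) := by
  unfold diamondN
  rw [sum_filter, sum_product_right]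
  refine sum_congr rfl fun t ht => ?_
  rw [mem_range] at ht
  rw [← sum_filter, diamondN_row K t ht]

/-- The diamond is symmetric under `(s, t) ↦ (t, s)`. [folklore] -/
theorem mem_diamondN_swap (K : ℕ) (p : ℕ × ℕ) : p.swap ∈ diamondN K ↔ p ∈ diamondN K := by
  unfold diamondN
  simp only [mem_filter, mem_product, mem_range, Prod.fst_swap, Prod.snd_swap]
  constructor <;> rintro ⟨⟨h1, h2⟩, h3, h4, h5, h6⟩ <;> exact ⟨⟨h2, h1⟩, by omega, by omega, by omega, by omega⟩

/-- A sum of `f(s)` over the diamond equals the sum of `f(t)`. [folklore] -/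
theorem sum_diamondN_fst_eq_snd (K : ℕ) (f : ℕ → ℝ) :
    ∑ p ∈ diamondN K, f p.1 = ∑ p ∈ diamondN K, f p.2 := by
  refine sum_equiv (Equiv.prodComm ℕ ℕ) (fun p => ?_) (fun p _ => rfl)
  rw [Equiv.prodComm_apply, mem_diamondN_swap]

/-- **`|diamondN K| = 2K² + 2K + 1`.** [folklore] -/
theorem card_diamondN (K : ℕ) : ((diamondN K).card : ℝ) = 2 * (K : ℝ) ^ 2 + 2 * K + 1 := by
  rw [card_eq_sum_ones, Nat.cast_sum, sum_diamondN_eq]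
  simp only [Nat.cast_one, sum_const, Nat.card_Ico, nsmul_eq_mul, mul_one]
  have : ∀ t : ℕ, (((K + min t (2 * K - t) + 1 - (K - min t (2 * K - t)) : ℕ) : ℝ)) =
      2 * ((min t (2 * K - t) : ℕ) : ℝ) + 1 := fun t => by
    rw [show K + min t (2 * K - t) + 1 - (K - min t (2 * K - t)) = 2 * min t (2 * K - t) + 1 by omega]
    push_cast; ring
  simp_rw [this]
  have hsq : ∀ n : ℕ, ∑ u ∈ range n, (2 * (u : ℝ) + 1) = (n : ℝ) ^ 2 := fun n => by
    induction n with
    | zero => simp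
    | succ n ih => rw [sum_range_succ, ih]; push_cast; ring
  rw [sum_range_min_eq (fun w : ℕ => 2 * (w : ℝ) + 1) K, hsq]
  ring

/-- The diamond sum of the two lattice cosines. [folklore] -/
def diamondSum (K : ℕ) (θ : ℝ) : ℝ :=
  ∑ p ∈ diamondN K, (cos (((p.1 : ℝ) - K) * θ) + cos (((p.2 : ℝ) - K) * θ))

/-- A row of the diamond sums to a Dirichlet kernel:
`Σ_{s ∈ [K-w, K+w]} cos((s-K)θ) = dir w θ` (`w ≤ K`). [folklore] -/
theorem sum_Ico_cos_eq_dir {K w : ℕ} (hw : w ≤ K) (θ : ℝ) :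
    ∑ s ∈ Ico (K - w) (K + w + 1), cos (((s : ℝ) - K) * θ) = dir w θ := by
  rw [sum_Ico_eq_sum_range, show K + w + 1 - (K - w) = 2 * w + 1 by omega]
  unfold dir
  refine sum_congr rfl fun i _ => ?_
  rw [Nat.cast_add, Nat.cast_sub hw]
  ring_nf

/-- **The diamond sum is twice the folded row sum of Dirichlet kernels**:
`S_K(θ) = 2 Σ_{t<2K+1} dir w_t θ`. [folklore] -/
theorem diamondSum_eq_two_mul (K : ℕ) (θ : ℝ) :
    diamondSum K θ = 2 * ∑ t ∈ range (2 * K + 1), dir (min t (2 * K - t)) θ := by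
  unfold diamondSum
  rw [sum_add_distrib, ← sum_diamondN_fst_eq_snd K (fun s => cos (((s : ℝ) - K) * θ)), ← two_mul,
    sum_diamondN_eq]
  congr 1
  refine sum_congr rfl fun t ht => ?_
  exact sum_Ico_cos_eq_dir (by rw [mem_range] at ht; omega) θ

/-- **Closed form**: `sin²(θ/2) S_K(θ) = 2 sin(θ/2) sin((2K+1)θ/2) + 4 sin²(Kθ/2)`. [folklore] -/
theorem sin_sq_mul_diamondSum (K : ℕ) (θ : ℝ) :
    sin (θ / 2) ^ 2 * diamondSum K θ =
      2 * (sin (θ / 2) * sin ((2 * (K : ℝ) + 1) * θ / 2)) + 4 * sin ((K : ℝ) * (θ / 2)) ^ 2 := by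
  rw [diamondSum_eq_two_mul, mul_left_comm, sin_sq_mul_rowDirSum]
  ring

/-- **Lower bound at the lattice angle.** For `2 ≤ L` and `2K + 1 ≤ L`, with `θ = 2π/L`:
`S_K(2π/L) ≥ 4 L² sin²(Kπ/L) / π²` (drop the nonnegative `sin((2K+1)π/L)` term and use
`sin(π/L) ≤ π/L`). [folklore] -/
theorem diamondSum_ge {L K : ℕ} (hL : 2 ≤ L) (hK : 2 * K + 1 ≤ L) :
    4 * (L : ℝ) ^ 2 * sin ((K : ℝ) * π / L) ^ 2 / π ^ 2 ≤ diamondSum K (2 * π / L) := by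
  have hLpos : (0 : ℝ) < L := by exact_mod_cast (show 0 < L by omega)
  have hθ2 : 2 * π / L / 2 = π / L := by field_simp
  have hid := sin_sq_mul_diamondSum K (2 * π / L)
  rw [hθ2] at hid
  -- `0 < sin(π/L) ≤ π/L`
  have hxpos : 0 < π / L := div_pos pi_pos hLpos
  have hxle : π / L ≤ π / 2 := by
    rw [div_le_div_iff_of_pos_left pi_pos hLpos two_pos]; exact_mod_cast hL
  have hsin_pos : 0 < sin (π / L) := sin_pos_of_pos_of_lt_pi hxpos (by linarith [pi_pos])
  have hsin_le : sin (π / L) ≤ π / L := sin_le hxpos.le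
  -- `0 ≤ sin((2K+1)π/L)` since `(2K+1)π/L ≤ π`
  have hodd : 0 ≤ sin ((2 * (K : ℝ) + 1) * (2 * π / L) / 2) := by
    rw [show (2 * (K : ℝ) + 1) * (2 * π / L) / 2 = (2 * (K : ℝ) + 1) * π / L by ring]
    refine sin_nonneg_of_nonneg_of_le_pi (by positivity) ?_
    rw [div_le_iff₀ hLpos]
    have : (2 * (K : ℝ) + 1) ≤ L := by exact_mod_cast hK
    nlinarith [pi_pos]
  have hKx : (K : ℝ) * (π / L) = (K : ℝ) * π / L := by ring
  rw [hKx] at hid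
  -- from the identity: `sin²(π/L) S ≥ 4 sin²(Kπ/L)`
  have h1 : 4 * sin ((K : ℝ) * π / L) ^ 2 ≤ sin (π / L) ^ 2 * diamondSum K (2 * π / L) := by
    rw [hid]; nlinarith [mul_nonneg hsin_pos.le hodd]
  -- and `sin²(π/L) ≤ π²/L²`
  have h2 : sin (π / L) ^ 2 ≤ π ^ 2 / (L : ℝ) ^ 2 := by
    rw [← div_pow]; exact pow_le_pow_left₀ hsin_pos.le hsin_le 2
  have hS : 0 ≤ diamondSum K (2 * π / L) := by
    by_contra hneg
    push Not at hneg
    have : sin (π / L) ^ 2 * diamondSum K (2 * π / L) < 0 :=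
      mul_neg_of_pos_of_neg (pow_pos hsin_pos 2) hneg
    nlinarith [sq_nonneg (sin ((K : ℝ) * π / L))]
  have h3 : sin (π / L) ^ 2 * diamondSum K (2 * π / L) ≤ π ^ 2 / (L : ℝ) ^ 2 * diamondSum K (2 * π / L) :=
    mul_le_mul_of_nonneg_right h2 hS
  rw [div_le_iff₀ (pow_pos pi_pos 2)]
  have hL2 : (0 : ℝ) < (L : ℝ) ^ 2 := by positivity
  have := h1.trans h3
  rw [div_mul_eq_mul_div, le_div_iff₀ hL2] at this
  linarith

end Summit.HubbardSuperconductivity.HubbardSuperconductivity.Theorems.WeakCouplingSpin
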